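import Summits.ResolutionOfSingularities.ResolutionOfSingularities.Theses.HomologicalConductor
import Literature.RingTheory.CohomologyAnnihilator.Basic
import Literature.AlgebraicGeometry.Resolution.LocalBlowup
import Literature.AlgebraicGeometry.Resolution.ZariskiPatchingProperModels
import Literature.AlgebraicGeometry.Resolution.ProperModelsPatchingOfResolution
import Literature.AlgebraicGeometry.Resolution.IntegralClosureEssFiniteType
import Summits.ResolutionOfSingularities.ResolutionOfSingularities.Theorems.HomologicalConductorGlobalisationLocEq
import Summits.ResolutionOfSingularities.ResolutionOfSingularities.Theorems.HomologicalConductorGlobalisationChartStep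
import Summits.ResolutionOfSingularities.ResolutionOfSingularities.Theorems.HomologicalConductorGlobalisationNrmStep
import Summits.ResolutionOfSingularities.ResolutionOfSingularities.Theorems.HomologicalConductorGlobalisationTowerModel
import Summits.ResolutionOfSingularities.ResolutionOfSingularities.Theorems.HomologicalConductorGlobalisationLurel
import Summits.ResolutionOfSingularities.ResolutionOfSingularities.Theorems.HomologicalConductorGlobalisation
import Summits.ResolutionOfSingularities.ResolutionOfSingularities.Theses.Valuative
import HarnessLib

/-!
# Crux `Globalisation` (stmt-ResolutionOfSingularities-16486) — line `birth_HomologicalConductor`, RESHAPED (lead, v3: "lu-patching cut", last stub = item stmt-0642 verbatim)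

Route `ResolutionOfSingularities/HomologicalConductor`, crux #5: `Globalisation` =
`∀ p prime, ValuativeTermination p → ResolutionInChar p`, where `ValuativeTermination p` (the
antecedent, verbatim the conclusion of crux `NoZeno` at `p`) says that along every valuation ring
`O ⊇ A` of `K` the canonical normalised ca-tower `T₀ = A_centre, T_(m+1) = (normalisation of
T_m[ca(T_m)/x])_centre` of every finitely generated affine model `A` reaches a regular local ring.

## Why the registered cut is reshaped

The birth skeleton (sha 59ad0abb…) cut the crux as `CaSheaf → Atlas → UniformLevel → GlobalTower`
("ca is a sheaf, so the valuation-wise towers are local rings of ONE global tower; compactness").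
Its stub `stub_caSheaf : ∀ p prime, CaSheaf p` is REFUTED in Lean and landed
(`Theorems/Globalisation/Negative/StubCaSheafFalse.lean`: `Negative.caSheaf_false`, cusp × 𝔸¹ at
the generic point of the singular line), so `Globalisation_of h₀ h₁ h₂ h₃` can never be fed and the
stubs `CaSheaf p → …` are vacuous. The stalkwise cohomology annihilator is not even compatible with
generisation (`ca(R_𝔪)R_𝔮 = (x², y) ⊊ (x, y) = ca(R_𝔮)`), so no "one global tower" exists at the
level of ideals. What the antecedent still IS, provably, is a LOCAL UNIFORMIZATION statement; and
the tree proves Zariski's programme in every dimension modulo the patching of two proper models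
(`resolutionInChar_of_properTwoModelPatching_of_relLU`, ZariskiPatchingProperModels.lean).

## The cut (six named stubs; `Globalisation_of` proved by pure logic)

* `stub_locEq` (S) — the route's `loc A` IS the tree's `locAtCentre A O` (LocalBlowup.lean):
  `B_(𝔪_O ∩ B)` read inside `K`.
* `stub_chartStep` (M) — the chart generators are finitely many modulo units: for
  `B = locAtCentre D O` with `D` finitely generated (so `B` is Noetherian) and any ideal `I` of `B`,
  finitely many elements `t` of the chart set `{c/x : c ∈ I, x ∈ I of minimal value}` already give
  `chart set ⊆ locAtCentre D[t] O` (write `c = Σ bᵢ gᵢ`, `c/x = Σ bᵢ (gᵢ/x₀)(x₀/x)`, and `x₀/x` is a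
  unit of the local ring `locAtCentre D[t] O` dominated by `O`).
* `stub_nrmStep` (M) — normalisation stays essentially of finite type: for `D ≤ C ⊆ locAtCentre D O`
  (`D` finitely generated, `Frac D = K`) the elements of `K` integral over `C` lie in
  `locAtCentre D' O` for a finitely generated `D ≤ D' ⊆ O` consisting of `C`-integral elements
  (`D'` = `D` + module generators of the integral closure of `D` in `K`, finite by E. Noether /
  `IntegralClosureEssFiniteType.lean`; an element integral over `S⁻¹D` is `(integral over D)/s`).
* `stub_towerModel` (M, lead) — from the three steps: every stage of the canonical tower is the
  local ring at the centre of `O` of a finitely generated model, `tower A m = locAtCentre A_m O` with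
  `A ≤ A_m ⊆ O`, `A_m` finitely generated (induction on `m`; `ca(T_m)` is an ideal of `T_m`,
  `Subalgebra.image_coe_cohomologyAnnihilator`).
* `stub_lurel` (S, lead) — hence valuative termination of the canonical tower IS relative local
  uniformization in characteristic `p` (`LUrel_p`, the shape consumed by the tree's patching
  theorems): enlarge `R` to an affine model, run the tower, read regularity of `T_m` on
  `Localization.AtPrime` of the centre (`isRegularLocalRing_locAtCentre_iff`).
* `stub_patchingRel` (CRUX-SIZED, open; v3) — `LUrel_p → ResolutionInChar p` for every prime `p`:
  VERBATIM route Valuative's crux `PatchingRel` (stmt-ResolutionOfSingularities-0642, Zariski's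
  patching problem "relative local uniformization ⇒ resolution", open in dimension `≥ 4`;
  `sig_stub_patchingRel_iff : Sig.stub_patchingRel ↔ Valuative.PatchingRel := Iff.rfl`). It replaces
  v2's `stub_twoModelPatching` (`∀ p prime, ProperModel.TwoModelPatching p`), which implies it
  (`stub_patchingRel_of_twoModelPatching`, Zariski's programme with proper models) and is equivalent
  to it under `LUrel_p` — so nothing is lost, and the residual stub is now an EXISTING item that
  another route staffs. Under the crux's antecedent the stub is also NECESSARY
  (`patchingRel_of_globalisation` below): modulo stubs 1–5 the crux IS `PatchingRel` weakened by the
  stronger antecedent `VT_p`.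
* `Globalisation_of : Sig.stub_locEq → … → Sig.stub_patchingRel → Globalisation` — PROVED:
  stubs 1–3 feed 4, 4 feeds 5 (`LUrel_p`), and stub 6 turns `LUrel_p` into `ResolutionInChar p`.
* MECHANISM VERDICT (v3): "globalise by canonicity" is impossible for the ca-tower, not only via the
  refuted `CaSheaf`: on the `A₂`-cylinder `k[x,y,u,z]/(xy − u³)` the level-1 towers at the generic
  point of the singular line (local rings of the minimal resolution of the transversal `A₂`,
  `ca(R_𝔮) = (x,y,u)`) and at its closed points (local rings of `NBl_{ca(R_𝔪)}`, with
  `ca(R_𝔪)R_𝔮 = (x, y, u²)`: ONE exceptional divisor) are not the local rings of ANY `X₁ → Spec R`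
  (Lean certificate `Theorems/Globalisation/Negative/A2CylinderCertificate.lean`, paper wrapper
  `Cruxes/Globalisation/NONLOCALITY-A2xA1.md`). Hence the composition through patching is the only
  shape a line for this crux can have.

Disproof used: `Negative.caSheaf_false` (kills the registered stub 1 and the sheaf lever; this cut
does not mention `CaSheaf`). Dead alternative recorded in `PICKED.md`.
-/

noncomputable section

-- single-problem summit: the doubled namespace component `ResolutionOfSingularities` is forced
set_option linter.dupNamespace false

open Literature.AlgebraicGeometry.Resolution
open Summit.ResolutionOfSingularities.ResolutionOfSingularities.Theses.HomologicalConductor (Globalisation)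

namespace Summit.ResolutionOfSingularities.ResolutionOfSingularities.Cruxes.Globalisation.Lines.BirthHomologicalConductor

/-! ## The predicates of the cut -/

/-- **Valuative termination of the canonical ca-tower in characteristic `p`** — the ANTECEDENT of
the crux at `p`, verbatim. [cite: IyengarTakahashi2014, Def. 2.1 (ca); route HomologicalConductor (the tower)] -/
def ValuativeTermination (p : ℕ) : Prop :=
  ∀ (k K : Type) [Field k] [CharP k p] [Field K] [Algebra k K] (O : ValuationSubring K) (A : Subalgebra k K), (∀ c : k, algebraMap k K c ∈ O) → A.FG → IsFractionRing ↥A K → A.toSubring ≤ O.toSubring → let ca : Subalgebra k K → Set K := fun A => {x : K | ∃ hx : x ∈ A, ∃ n : ℕ, ∀ i : ℕ, n ≤ i → ∀ (M N : ModuleCat.{0} ↥A), Module.Finite ↥A M → Module.Finite ↥A N → ∀ e : CategoryTheory.Abelian.Ext.{0} M N i, (⟨x, hx⟩ : ↥A) • e = 0}; let loc : Subalgebra k K → Subalgebra k K := fun A => Algebra.adjoin k {y : K | ∃ a ∈ A, ∃ s ∈ A, s⁻¹ ∈ O ∧ y = a * s⁻¹}; let chart : Subalgebra k K → Subalgebra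 k K := fun A => Algebra.adjoin k ((A : Set K) ∪ {y : K | ∃ c ∈ ca A, ∃ x ∈ ca A, x ≠ 0 ∧ (∀ c' ∈ ca A, c' * x⁻¹ ∈ O) ∧ y = c * x⁻¹}); let nrm : Subalgebra k K → Subalgebra k K := fun B => Algebra.adjoin k {y : K | IsIntegral ↥B y}; let tower : Subalgebra k K → ℕ → Subalgebra k K := fun A m => @Nat.rec (fun _ => Subalgebra k K) (loc A) (fun _ B => loc (nrm (chart B))) m; ∃ m : ℕ, IsRegularLocalRing ↥(tower A m)

/-- **Relative local uniformization in characteristic `p`** (`LUrel_p`), in the exact shape consumed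
by `resolutionInChar_of_properTwoModelPatching_of_relLU`. [cite: Piltant2013, Axiom 5; ZariskiSamuel1960, Ch. VI §17] -/
def LUrel (p : ℕ) : Prop :=
  ∀ (k K : Type) [Field k] [CharP k p] [Field K] [Algebra k K], (⊤ : IntermediateField k K).FG → ∀ O : ValuationSubring K, (∀ c : k, algebraMap k K c ∈ O) → ∀ R : Subalgebra k K, R.FG → R.toSubring ≤ O.toSubring → ∃ (A : Subalgebra k K) (h : A.toSubring ≤ O.toSubring), R ≤ A ∧ A.FG ∧ IsFractionRing ↥A K ∧ IsRegularLocalRing (Localization.AtPrime (Ideal.comap (Subring.inclusion h) (IsLocalRing.maximalIdeal ↥O)))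

/-- Sanity: the crux is literally `∀ p prime, ValuativeTermination p → ResolutionInChar p`. [folklore] -/
theorem globalisation_iff :
    Globalisation ↔ ∀ p : ℕ, p.Prime → ValuativeTermination p →
      Literature.AlgebraicGeometry.Resolution.ResolutionInChar.{0} p :=
  Iff.rfl

/-! ## The six stub STATEMENTS by name -/

/-- Statement of `stub_locEq`. [cite: NovacoskiSpivakovsky2014, Def. 2.8] -/
def Sig.stub_locEq : Prop :=
  ∀ {k K : Type} [Field k] [Field K] [Algebra k K] (O : ValuationSubring K) (B : Subalgebra k K), B.toSubring ≤ O.toSubring → (Algebra.adjoin k {y : K | ∃ a ∈ B, ∃ s ∈ B, s⁻¹ ∈ O ∧ y = a * s⁻¹}).toSubring = Literature.AlgebraicGeometry.Resolution.locAtCentre B.toSubring O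

/-- Statement of `stub_chartStep`. [cite: NovacoskiSpivakovsky2014, Def. 2.11] -/
def Sig.stub_chartStep : Prop :=
  ∀ {k K : Type} [Field k] [Field K] [Algebra k K] (O : ValuationSubring K) (D : Subalgebra k K), D.FG → D.toSubring ≤ O.toSubring → ∀ (B : Subalgebra k K), B.toSubring = Literature.AlgebraicGeometry.Resolution.locAtCentre D.toSubring O → ∀ I : Ideal ↥B, ∃ t : Finset K, (↑t : Set K) ⊆ {y : K | ∃ c ∈ (((↑) : ↥B → K) '' (I : Set ↥B)), ∃ x ∈ (((↑) : ↥B → K) '' (I : Set ↥B)), x ≠ 0 ∧ (∀ c' ∈ (((↑) : ↥B → K) '' (I : Set ↥B)), c' * x⁻¹ ∈ O) ∧ y = c * x⁻¹} ∧ {y : K | ∃ c ∈ (((↑) : ↥B → K) '' (I : Set ↥B)), ∃ x ∈ (((↑) : ↥B → K) '' (I : Set ↥B)), x ≠ 0 ∧ (∀ c' ∈ (((↑) : ↥B → K) '' (I : Set ↥B)), c' * x⁻¹ ∈ O) ∧ y = c * x⁻¹} ⊆ (Literature.AlgebraicGeometry.Resolution.locAtCentre (Algebra.adjoin k ((D :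 Set K) ∪ ↑t)).toSubring O : Set K)

/-- Statement of `stub_nrmStep`. [cite: Liu2002, Prop. 4.1.27; StacksProject, Tag 0307] -/
def Sig.stub_nrmStep : Prop :=
  ∀ {k K : Type} [Field k] [Field K] [Algebra k K] (O : ValuationSubring K) (D : Subalgebra k K), D.FG → IsFractionRing ↥D K → D.toSubring ≤ O.toSubring → ∀ (C : Subalgebra k K), D ≤ C → C.toSubring ≤ Literature.AlgebraicGeometry.Resolution.locAtCentre D.toSubring O → ∃ D' : Subalgebra k K, D'.FG ∧ D ≤ D' ∧ D'.toSubring ≤ O.toSubring ∧ (D' : Set K) ⊆ {y : K | IsIntegral ↥C y} ∧ {y : K | IsIntegral ↥C y} ⊆ (Literature.AlgebraicGeometry.Resolution.locAtCentre D'.toSubring O : Set K)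

/-- Statement of `stub_towerModel` (conclusion). [cite: ZariskiSamuel1960, Ch. VI §17] -/
def Sig.TowerModel : Prop :=
  ∀ {k K : Type} [Field k] [Field K] [Algebra k K] (O : ValuationSubring K) (A : Subalgebra k K), A.FG → IsFractionRing ↥A K → A.toSubring ≤ O.toSubring → ∀ m : ℕ, let ca : Subalgebra k K → Set K := fun A => {x : K | ∃ hx : x ∈ A, ∃ n : ℕ, ∀ i : ℕ, n ≤ i → ∀ (M N : ModuleCat.{0} ↥A), Module.Finite ↥A M → Module.Finite ↥A N → ∀ e : CategoryTheory.Abelian.Ext.{0} M N i, (⟨x, hx⟩ : ↥A) • e = 0}; let loc : Subalgebra k K → Subalgebra k K := fun A => Algebra.adjoin k {y : K | ∃ a ∈ A, ∃ s ∈ A, s⁻¹ ∈ O ∧ y = a * s⁻¹}; let chart : Subalgebra k K → Subalgebra k K := fun A => Algebra.adjoin k ((A : Set K) ∪ {y : K | ∃ c ∈ ca A, ∃ x ∈ ca A, x ≠ 0 ∧ (∀ c' ∈ ca A, c' * x⁻¹ ∈ O) ∧ y = c * x⁻¹}); let nrm : Subalgebra k K → Subalgebra k K := fun B => Algebra.adjoin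 k {y : K | IsIntegral ↥B y}; let tower : Subalgebra k K → ℕ → Subalgebra k K := fun A m => @Nat.rec (fun _ => Subalgebra k K) (loc A) (fun _ B => loc (nrm (chart B))) m; ∃ Am : Subalgebra k K, Am.FG ∧ A ≤ Am ∧ Am.toSubring ≤ O.toSubring ∧ (tower A m).toSubring = Literature.AlgebraicGeometry.Resolution.locAtCentre Am.toSubring O

/-- Statement of `stub_towerModel`: the three step lemmas give the tower of models. [folklore] -/
def Sig.stub_towerModel : Prop :=
  Sig.stub_locEq → Sig.stub_chartStep → Sig.stub_nrmStep → Sig.TowerModel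

/-- Statement of `stub_lurel`: a tower of models that terminates is a local uniformization. [folklore] -/
def Sig.stub_lurel : Prop :=
  Sig.TowerModel → ∀ p : ℕ, ValuativeTermination p → LUrel p

/-- Statement of `stub_patchingRel`: relative local uniformization implies resolution, in every prime
characteristic — verbatim route Valuative's crux `PatchingRel` (stmt-0642; OPEN in dimension ≥ 4).
[cite: Piltant2013, Prop. 5.1 and Cor. 5.7; ZariskiSamuel1960, Ch. VI §17] -/
def Sig.stub_patchingRel : Prop :=
  ∀ p : ℕ, p.Prime → LUrel p → Literature.AlgebraicGeometry.Resolution.ResolutionInChar.{0} p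

/-- The v3 stub IS route Valuative's crux `PatchingRel` (stmt-ResolutionOfSingularities-0642),
definitionally. [folklore] -/
theorem sig_stub_patchingRel_iff :
    Sig.stub_patchingRel ↔ Summit.ResolutionOfSingularities.ResolutionOfSingularities.Theses.Valuative.PatchingRel :=
  Iff.rfl

/-! ## The stubs -/

/-- **STUB 1 — LANDED (p166169, `Theorems/HomologicalConductorGlobalisationLocEq.lean`).** The route's `loc` is `locAtCentre`. [cite: NovacoskiSpivakovsky2014, Def. 2.8] -/
theorem stub_locEq {k K : Type} [Field k] [Field K] [Algebra k K] (O : ValuationSubring K)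
    (B : Subalgebra k K) (hBO : B.toSubring ≤ O.toSubring) :
    (Algebra.adjoin k {y : K | ∃ a ∈ B, ∃ s ∈ B, s⁻¹ ∈ O ∧ y = a * s⁻¹}).toSubring =
      Literature.AlgebraicGeometry.Resolution.locAtCentre B.toSubring O :=
  _root_.Summit.ResolutionOfSingularities.ResolutionOfSingularities.Theorems.HomologicalConductorGlobalisation.stub_locEq O B hBO

/-- **STUB 2 — LANDED (p166281, `…ChartStep.lean`).** Finitely many chart generators suffice modulo units of the next local ring.
[cite: NovacoskiSpivakovsky2014, Def. 2.11] -/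
theorem stub_chartStep {k K : Type} [Field k] [Field K] [Algebra k K] (O : ValuationSubring K)
    (D : Subalgebra k K) (hD : D.FG) (hDO : D.toSubring ≤ O.toSubring) (B : Subalgebra k K)
    (hB : B.toSubring = Literature.AlgebraicGeometry.Resolution.locAtCentre D.toSubring O)
    (I : Ideal ↥B) :
    ∃ t : Finset K, (↑t : Set K) ⊆ {y : K | ∃ c ∈ (((↑) : ↥B → K) '' (I : Set ↥B)), ∃ x ∈ (((↑) : ↥B → K) '' (I : Set ↥B)), x ≠ 0 ∧ (∀ c' ∈ (((↑) : ↥B → K) '' (I : Set ↥B)), c' * x⁻¹ ∈ O) ∧ y = c * x⁻¹} ∧ {y : K | ∃ c ∈ (((↑) : ↥B → K) '' (I : Set ↥B)), ∃ x ∈ (((↑) : ↥B → K) '' (I : Set ↥B)), x ≠ 0 ∧ (∀ c' ∈ (((↑) : ↥B → K) '' (I : Set ↥B)), c' * x⁻¹ ∈ O) ∧ y = c * x⁻¹} ⊆ (Literature.AlgebraicGeometry.Resolution.locAtCentre (Algebra.adjoin k ((D : Set K) ∪ ↑t)).toSubring O : Set K) :=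
  _root_.Summit.ResolutionOfSingularities.ResolutionOfSingularities.Theorems.HomologicalConductorGlobalisation.stub_chartStep O D hD hDO B hB I

/-- **STUB 3 — LANDED (p166358, `…NrmStep.lean`).** Normalisation of a chart stays the localisation of a finitely generated model.
[cite: Liu2002, Prop. 4.1.27; StacksProject, Tag 0307] -/
theorem stub_nrmStep {k K : Type} [Field k] [Field K] [Algebra k K] (O : ValuationSubring K)
    (D : Subalgebra k K) (hD : D.FG) (hDK : IsFractionRing ↥D K) (hDO : D.toSubring ≤ O.toSubring)
    (C : Subalgebra k K) (hDC : D ≤ C)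
    (hC : C.toSubring ≤ Literature.AlgebraicGeometry.Resolution.locAtCentre D.toSubring O) :
    ∃ D' : Subalgebra k K, D'.FG ∧ D ≤ D' ∧ D'.toSubring ≤ O.toSubring ∧
      (D' : Set K) ⊆ {y : K | IsIntegral ↥C y} ∧
      {y : K | IsIntegral ↥C y} ⊆ (Literature.AlgebraicGeometry.Resolution.locAtCentre D'.toSubring O : Set K) :=
  _root_.Summit.ResolutionOfSingularities.ResolutionOfSingularities.Theorems.HomologicalConductorGlobalisation.stub_nrmStep O D hD hDK hDO C hDC hC

/-- **STUB 4 — LANDED (p166643, `…TowerModel.lean`).** Every stage of the canonical tower is the local ring at the centre of a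
finitely generated model. [cite: ZariskiSamuel1960, Ch. VI §17] -/
theorem stub_towerModel (h₁ : ∀ {k K : Type} [Field k] [Field K] [Algebra k K] (O : ValuationSubring K) (B : Subalgebra k K), B.toSubring ≤ O.toSubring → (Algebra.adjoin k {y : K | ∃ a ∈ B, ∃ s ∈ B, s⁻¹ ∈ O ∧ y = a * s⁻¹}).toSubring = Literature.AlgebraicGeometry.Resolution.locAtCentre B.toSubring O) (h₂ : ∀ {k K : Type} [Field k] [Field K] [Algebra k K] (O : ValuationSubring K) (D : Subalgebra k K), D.FG → D.toSubring ≤ O.toSubring → ∀ (B : Subalgebra k K), B.toSubring = Literature.AlgebraicGeometry.Resolution.locAtCentre D.toSubring O → ∀ I : Ideal ↥B, ∃ t : Finset K, (↑t : Set K) ⊆ {y : K | ∃ c ∈ (((↑) : ↥B → K) '' (I : Set ↥B)), ∃ x ∈ (((↑) : ↥B → K) '' (I : Set ↥B)), x ≠ 0 ∧ (∀ c' ∈ (((↑) : ↥B → K) '' (I : Set ↥B)), c' * x⁻¹ ∈ O) ∧ y = c * x⁻¹} ∧ {y : K | ∃ c ∈ (((↑) : ↥B → K) '' (I : Set ↥B)),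 ∃ x ∈ (((↑) : ↥B → K) '' (I : Set ↥B)), x ≠ 0 ∧ (∀ c' ∈ (((↑) : ↥B → K) '' (I : Set ↥B)), c' * x⁻¹ ∈ O) ∧ y = c * x⁻¹} ⊆ (Literature.AlgebraicGeometry.Resolution.locAtCentre (Algebra.adjoin k ((D : Set K) ∪ ↑t)).toSubring O : Set K)) (h₃ : ∀ {k K : Type} [Field k] [Field K] [Algebra k K] (O : ValuationSubring K) (D : Subalgebra k K), D.FG → IsFractionRing ↥D K → D.toSubring ≤ O.toSubring → ∀ (C : Subalgebra k K), D ≤ C → C.toSubring ≤ Literature.AlgebraicGeometry.Resolution.locAtCentre D.toSubring O → ∃ D' : Subalgebra k K, D'.FG ∧ D ≤ D' ∧ D'.toSubring ≤ O.toSubring ∧ (D' : Set K) ⊆ {y : K | IsIntegral ↥C y} ∧ {y : K | IsIntegral ↥C y} ⊆ (Literature.AlgebraicGeometry.Resolution.locAtCentre D'.toSubring O : Set K)) :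
    ∀ {k K : Type} [Field k] [Field K] [Algebra k K] (O : ValuationSubring K) (A : Subalgebra k K), A.FG → IsFractionRing ↥A K → A.toSubring ≤ O.toSubring → ∀ m : ℕ, let ca : Subalgebra k K → Set K := fun A => {x : K | ∃ hx : x ∈ A, ∃ n : ℕ, ∀ i : ℕ, n ≤ i → ∀ (M N : ModuleCat.{0} ↥A), Module.Finite ↥A M → Module.Finite ↥A N → ∀ e : CategoryTheory.Abelian.Ext.{0} M N i, (⟨x, hx⟩ : ↥A) • e = 0}; let loc : Subalgebra k K → Subalgebra k K := fun A => Algebra.adjoin k {y : K | ∃ a ∈ A, ∃ s ∈ A, s⁻¹ ∈ O ∧ y = a * s⁻¹}; let chart : Subalgebra k K → Subalgebra k K := fun A => Algebra.adjoin k ((A : Set K) ∪ {y : K | ∃ c ∈ ca A, ∃ x ∈ ca A, x ≠ 0 ∧ (∀ c' ∈ ca A, c' * x⁻¹ ∈ O) ∧ y = c * x⁻¹}); let nrm : Subalgebra k K → Subalgebra k K := fun B => Algebra.adjoin k {y : K | IsIntegral ↥B y}; let tower : Subalgebra k K → ℕ → Subalgebra k K := fun A m => @Nat.rec (fun _ =>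 Subalgebra k K) (loc A) (fun _ B => loc (nrm (chart B))) m; ∃ Am : Subalgebra k K, Am.FG ∧ A ≤ Am ∧ Am.toSubring ≤ O.toSubring ∧ (tower A m).toSubring = Literature.AlgebraicGeometry.Resolution.locAtCentre Am.toSubring O :=
  _root_.Summit.ResolutionOfSingularities.ResolutionOfSingularities.Theorems.HomologicalConductorGlobalisation.stub_towerModel h₁ h₂ h₃

/-- **STUB 5 — LANDED (p166511, `…Lurel.lean`).** Valuative termination of the canonical tower is
relative local uniformization. [cite: Piltant2013, Axiom 5] -/
theorem stub_lurel (h₄ : ∀ {k K : Type} [Field k] [Field K] [Algebra k K] (O : ValuationSubring K) (A : Subalgebra k K), A.FG → IsFractionRing ↥A K → A.toSubring ≤ O.toSubring → ∀ m : ℕ, let ca : Subalgebra k K → Set K := fun A => {x : K | ∃ hx : x ∈ A, ∃ n : ℕ, ∀ i : ℕ, n ≤ i → ∀ (M N : ModuleCat.{0} ↥A), Module.Finite ↥A M → Module.Finite ↥A N → ∀ e : CategoryTheory.Abelian.Ext.{0} M N i, (⟨x, hx⟩ : ↥A) • e = 0}; let loc : Subalgebra k K → Subalgebra k K := fun A =>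 Algebra.adjoin k {y : K | ∃ a ∈ A, ∃ s ∈ A, s⁻¹ ∈ O ∧ y = a * s⁻¹}; let chart : Subalgebra k K → Subalgebra k K := fun A => Algebra.adjoin k ((A : Set K) ∪ {y : K | ∃ c ∈ ca A, ∃ x ∈ ca A, x ≠ 0 ∧ (∀ c' ∈ ca A, c' * x⁻¹ ∈ O) ∧ y = c * x⁻¹}); let nrm : Subalgebra k K → Subalgebra k K := fun B => Algebra.adjoin k {y : K | IsIntegral ↥B y}; let tower : Subalgebra k K → ℕ → Subalgebra k K := fun A m => @Nat.rec (fun _ => Subalgebra k K) (loc A) (fun _ B => loc (nrm (chart B))) m; ∃ Am : Subalgebra k K, Am.FG ∧ A ≤ Am ∧ Am.toSubring ≤ O.toSubring ∧ (tower A m).toSubring = Literature.AlgebraicGeometry.Resolution.locAtCentre Am.toSubring O) (p : ℕ) (hVT : ∀ (k K : Type) [Field k] [CharP k p] [Field K] [Algebra k K] (O : ValuationSubring K) (A : Subalgebra k K), (∀ c : k, algebraMap k K c ∈ O) → A.FG → IsFractionRing ↥A K → A.toSubring ≤ O.toSubring → let ca : Subalgebra k K → Set K := fun A => {x : K | ∃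 hx : x ∈ A, ∃ n : ℕ, ∀ i : ℕ, n ≤ i → ∀ (M N : ModuleCat.{0} ↥A), Module.Finite ↥A M → Module.Finite ↥A N → ∀ e : CategoryTheory.Abelian.Ext.{0} M N i, (⟨x, hx⟩ : ↥A) • e = 0}; let loc : Subalgebra k K → Subalgebra k K := fun A => Algebra.adjoin k {y : K | ∃ a ∈ A, ∃ s ∈ A, s⁻¹ ∈ O ∧ y = a * s⁻¹}; let chart : Subalgebra k K → Subalgebra k K := fun A => Algebra.adjoin k ((A : Set K) ∪ {y : K | ∃ c ∈ ca A, ∃ x ∈ ca A, x ≠ 0 ∧ (∀ c' ∈ ca A, c' * x⁻¹ ∈ O) ∧ y = c * x⁻¹}); let nrm : Subalgebra k K → Subalgebra k K := fun B => Algebra.adjoin k {y : K | IsIntegral ↥B y}; let tower : Subalgebra k K → ℕ → Subalgebra k K := fun A m => @Nat.rec (fun _ => Subalgebra k K) (loc A) (fun _ B => loc (nrm (chart B))) m; ∃ m : ℕ, IsRegularLocalRing ↥(tower A m)) :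
    ∀ (k K : Type) [Field k] [CharP k p] [Field K] [Algebra k K], (⊤ : IntermediateField k K).FG → ∀ O : ValuationSubring K, (∀ c : k, algebraMap k K c ∈ O) → ∀ R : Subalgebra k K, R.FG → R.toSubring ≤ O.toSubring → ∃ (A : Subalgebra k K) (h : A.toSubring ≤ O.toSubring), R ≤ A ∧ A.FG ∧ IsFractionRing ↥A K ∧ IsRegularLocalRing (Localization.AtPrime (Ideal.comap (Subring.inclusion h) (IsLocalRing.maximalIdeal ↥O))) :=
  _root_.Summit.ResolutionOfSingularities.ResolutionOfSingularities.Theorems.HomologicalConductorGlobalisation.stub_lurel h₄ p hVT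

/-- **STUB 6 (CRUX-SIZED, OPEN in dimension ≥ 4; v3) — the only `sorry` left.** Relative local
uniformization in characteristic `p` implies resolution in characteristic `p` — verbatim the `p`-slice
of route Valuative's crux `PatchingRel` (stmt-ResolutionOfSingularities-0642): Zariski's patching
problem. [cite: Piltant2013, Prop. 5.1 and Cor. 5.7; open in trdeg ≥ 4, p. 2] -/
theorem stub_patchingRel (p : ℕ) (hp : p.Prime) (hLU : ∀ (k K : Type) [Field k] [CharP k p] [Field K] [Algebra k K], (⊤ : IntermediateField k K).FG → ∀ O : ValuationSubring K, (∀ c : k, algebraMap k K c ∈ O) → ∀ R : Subalgebra k K, R.FG → R.toSubring ≤ O.toSubring → ∃ (A : Subalgebra k K) (h : A.toSubring ≤ O.toSubring), R ≤ A ∧ A.FG ∧ IsFractionRing ↥A K ∧ IsRegularLocalRing (Localization.AtPrime (Ideal.comap (Subring.inclusion h) (IsLocalRing.maximalIdeal ↥O)))) :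
    Literature.AlgebraicGeometry.Resolution.ResolutionInChar.{0} p := by
  sorry

/-- v2's stub implies v3's: two-model patching of proper models in characteristic `p` turns
`LUrel_p` into `ResolutionInChar p` (Zariski's programme with proper models,
`resolutionInChar_of_properTwoModelPatching_of_relLU`). [cite: Piltant2013, Cor. 5.7] -/
theorem stub_patchingRel_of_twoModelPatching
    (h : ∀ p : ℕ, p.Prime → ProperModel.TwoModelPatching.{0} p) : Sig.stub_patchingRel :=
  fun p hp hLU => resolutionInChar_of_properTwoModelPatching_of_relLU (h p hp) hLU

/-! ## The composition (kernel-checked; no `sorry` in its own term) -/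

/-- **`Globalisation` from the six stub statements** — PROVED: the step lemmas give the tower of
models, hence `LUrel_p` from the crux's antecedent (stub 5), and stub 6 (= route Valuative's
`PatchingRel` at `p`) returns `ResolutionInChar p` from `LUrel_p`. [cite: Piltant2013, Cor. 5.7] -/
theorem Globalisation_of :
    Sig.stub_locEq → Sig.stub_chartStep → Sig.stub_nrmStep → Sig.stub_towerModel → Sig.stub_lurel →
      Sig.stub_patchingRel → Globalisation :=
  fun h₁ h₂ h₃ h₄ h₅ h₆ p hp hVT => h₆ p hp (h₅ (h₄ h₁ h₂ h₃) p hVT)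

/-- **The crux `Globalisation`, assembled from the six stubs** (its only `sorry`s are the stubs). -/
theorem Globalisation_proof : Globalisation :=
  Globalisation_of stub_locEq stub_chartStep stub_nrmStep stub_towerModel stub_lurel stub_patchingRel

/-! ## Sanity: stub 6 is necessary under the antecedent; it is the landed inter-route edge -/

/-- Conversely the crux gives stub 6 back at every prime where its own antecedent holds: modulo
stubs 1–5 and under `VT_p` the crux IS `PatchingRel` at `p`. [folklore] -/
theorem patchingRel_of_globalisation (hG : Globalisation) (p : ℕ) (hp : p.Prime)
    (hVT : ValuativeTermination p) :
    LUrel p → Literature.AlgebraicGeometry.Resolution.ResolutionInChar.{0} p :=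
  fun _ => hG p hp hVT

/-- The composition with stubs 1–5 discharged (through the landed assembly
`lurel_of_valuativeTermination`, p167871): stub 6 alone gives the crux — the same term as the LANDED
inter-route edge `globalisation_of_patchingRel : Valuative.PatchingRel → Globalisation`
(`Theorems/HomologicalConductorGlobalisationCruxMap.lean`, p172478). [folklore] -/
theorem Globalisation_of_stub_patchingRel (h₆ : Sig.stub_patchingRel) : Globalisation :=
  fun p hp hVT => h₆ p hp
    (Summit.ResolutionOfSingularities.ResolutionOfSingularities.Theorems.HomologicalConductorGlobalisation.lurel_of_valuativeTermination
      p hVT)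

end Summit.ResolutionOfSingularities.ResolutionOfSingularities.Cruxes.Globalisation.Lines.BirthHomologicalConductor

end
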